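import Mathlib
import HarnessLib
import Literature.Probability.MarkovChains.IndependenceSamplerSpectrum
import Literature.Probability.MarkovChains.ReversibleSpectrumReal

/-!
# The spectral gap of the Metropolized independence sampler is `γ = 1 − λ₁ = 1/w⋆`
# (Liu 1996 Thm 2.1 / Liu 2001 Thm 13.4.1 read through Levin–Peres–Wilmer's `γ := 1 − λ₂` and
# Lemma 13.7: `Gap_R(IMH) = 1/w⋆`)

HONEST FRAMING: exact (Metropolis-corrected) sampling algorithms for lattice gauge theory; figures
of merit are autocorrelation/cost numbers at stated couplings and volumes; no continuum-physics claim.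

Sources.  J. S. Liu, *Metropolized independent sampling with comparisons to rejection sampling and
importance sampling*, Statistics and Computing 6 (1996) 113–119 [Liu1996IMH], Theorem 2.1 — restated
with proof as Theorem 13.4.1 of J. S. Liu, *Monte Carlo Strategies in Scientific Computing*, Springer
2001 [Liu2001MonteCarlo], §13.4, and as Theorem 8 of G. Wang, *Exact convergence analysis of the
independent Metropolis–Hastings algorithms*, Bernoulli 28 (2022) [Wang2022IMHExact], §4 ("Theorem 8
(Theorem 2.1 of Liu)"): for the independence sampler with target `π` and proposal `p` on a finite
space, labels sorted by decreasing importance weight `w = π/p`, "all the eigenvalues of the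
transition matrix are `λ₀ = 1 > λ₁ ≥ λ₂ ≥ ⋯ ≥ λ_{n−1} ≥ 0`, where `λ_k = Σ_{i ≥ k}(p_i − π_i/w_k)`",
in particular (Liu 2001, the paragraph before Lemma 13.4.1) "the second largest eigenvalue `λ₁` … is
equal to `1 − 1/w₁`".  D. A. Levin, Y. Peres (with E. L. Wilmer), *Markov Chains and Mixing Times*,
2nd ed. [LevinPeres2017], §12.2 ("the spectral gap of a reversible chain is defined by `γ := 1 − λ₂`")
and §13.2.1 Lemma 13.7 (`γ = min{𝓔(f) : f ⊥_π 1, ‖f‖_π = 1}`).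

This file turns the eigen-analysis of `IndependenceSamplerSpectrum.lean` (Liu's `λ_k`, the
eigenvectors `v_k`, `λ⋆ = 1 − 1/w⋆`, `t_rel = w⋆`) into the statement about the SPECTRAL GAP in the
tree's two vocabularies — `spectralGap π P = γ = 1 − λ₂` of `SpectralGapVariational.lean` (with
`λ₂ = secondEigenvalue = max orthEigenvalues`, the top of the spectrum on `1^⊥`) and Andrieu–Vihola's
right spectral gap `spectralGapR π P = Gap_R = inf{𝓔(f) : f ⊥_π 1, ‖f‖_π = 1}` of
`PeskunOrdering.lean` — which is the quantity the multi-proposal comparison theorems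
(`MultiproposalPeskunBound.lean`, `IndependenceMultiproposalGapBound.lean`) are stated in.
Everything is PROVED (0 named facts).  Setting: finite `X`, target `p > 0` with `Σ p = 1`, proposal
LAW `q > 0` with `Σ q = 1`, IMH matrix `A = mhKernel (fun _ z => q z) p`, weight bound `p ≤ W·q`
attained at a state `x⋆` (so `W = w⋆ = max p/q`).

* `imh_isRowStochastic`, `imh_pos`, `imh_isIrreducible` — `A` is a stochastic matrix with ALL
  ENTRIES POSITIVE (towards a lighter state `p_j q_i/p_i > 0`, towards a heavier one `q_j > 0`,
  diagonal `q_k + λ_k ≥ q_k > 0`), hence irreducible [cite: Liu2001MonteCarlo, §13.4 (the displayed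
  matrix `A`, all of whose entries are products of positive `p`'s, `π`'s and `1/w`'s)].
* `imh_le_of_mem_orthEigenvalues` — every eigenvalue of `A` carried by a real eigenfunction
  `f ⊥_p 1` is `≤ 1 − 1/W`: such an eigenvalue is `≠ 1` (a harmonic function of the irreducible `A`
  is constant, Levin–Peres Lemma 12.1 (ii), and a constant `⊥_p 1` vanishes), so it is one of Liu's
  `λ_k ≤ λ₁ = 1 − 1/w⋆` [cite: Liu2001MonteCarlo, §13.4 Thm 13.4.1 (`1 > λ₁ ≥ λ_k`)].
* `imh_one_sub_inv_mem_orthEigenvalues` — `1 − 1/W` IS such an eigenvalue: Liu's vector `v_{x⋆}`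
  for the mode (tail set = all other states) is a real eigenfunction with `⟨v, 1⟩_p = 0`
  [cite: Liu2001MonteCarlo, §13.4 Thm 13.4.1 (the eigenvector `v₁`)].
* **`imh_secondEigenvalue_eq`** `λ₂(A) = 1 − 1/W`, **`imh_spectralGap_eq`** `γ(A) = 1/W` and, by
  Lemma 13.7, **`imh_spectralGapR_eq`** `Gap_R(A) = 1/W` [cite: Liu2001MonteCarlo, §13.4 Thm 13.4.1
  with the paragraph before Lemma 13.4.1 (`λ₁ = 1 − 1/w₁`)]; [cite: Liu1996IMH, Thm 2.1];
  [cite: Wang2022IMHExact, §4 Thm 8]; [cite: LevinPeres2017, §12.2 (`γ := 1 − λ₂`), §13.2.1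
  Lemma 13.7]; `imh_spectralGapR_eq_maxWeight` — the same with `W = w(x⋆) = max p/q` named by a
  heaviest state.
* `imh_spectralGap_eq_absSpectralGap` — for the independence sampler the spectral gap and the
  absolute spectral gap COINCIDE, `γ = γ⋆ = 1/W` (all eigenvalues are non-negative), so
  `t_rel = 1/γ = 1/Gap_R = W` (`IndependenceSamplerSpectrum.imh_relaxationTime_eq`)
  [cite: Liu2001MonteCarlo, §13.4 Thm 13.4.1 (`λ_{n−1} ≥ 0`)]; [cite: LevinPeres2017, §12.2].

NOT CLAIMED: general state spaces (Wang 2022 / Atchadé–Perron 2007 treat those); anything about a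
specific flow or any number of ours.
-/

namespace Literature.Probability.MarkovChains

open Finset

variable {X : Type*} [Fintype X] [DecidableEq X] {p q : X → ℝ}

/-! ## The IMH matrix is positive, stochastic, irreducible -/

/-- The independence-sampler matrix is row-stochastic. [cite: Liu2001MonteCarlo, §13.4 (the
transition matrix `A`)] -/
theorem imh_isRowStochastic (hp : ∀ x, 0 < p x) (hq : ∀ x, 0 < q x) (hq1 : ∑ x, q x = 1) :
    IsRowStochastic (mhKernel (fun _ z => q z) p) :=
  mhKernel_isRowStochastic (fun _ z => (hq z).le) (fun _ => hq1.le) hp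

/-- **Every entry of the IMH matrix is positive** (`p, q > 0`): `A i j = q_j` towards a heavier
state, `p_j q_i / p_i` towards a lighter one, `q_k + λ_k` on the diagonal.
[cite: Liu2001MonteCarlo, §13.4 (the displayed matrix `A`)] -/
theorem imh_pos (hp : ∀ x, 0 < p x) (hq : ∀ x, 0 < q x) (hq1 : ∑ x, q x = 1) (x y : X) :
    0 < mhKernel (fun _ z => q z) p x y := by
  by_cases hxy : y = x
  · subst hxy
    rw [imh_kernel_self hp hq1]
    exact add_pos_of_pos_of_nonneg (hq y) (imhEigenvalue_nonneg q p y)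
  · rw [mhKernel_of_ne hxy]
    exact lt_min (hq y) (div_pos (mul_pos (hp y) (hq x)) (hp x))

/-- Hence the IMH matrix is irreducible (one step suffices). [cite: Liu2001MonteCarlo, §13.4];
irreducibility as in [cite: LevinPeres2017, §1.3] -/
theorem imh_isIrreducible (hp : ∀ x, 0 < p x) (hq : ∀ x, 0 < q x) (hq1 : ∑ x, q x = 1) :
    IsIrreducible (mhKernel (fun _ z => q z) p : Matrix X X ℝ) :=
  fun x y => ⟨1, by rw [pow_one]; exact imh_pos hp hq hq1 x y⟩

/-! ## The spectrum on `1^⊥` lies below `1 − 1/W`, and `1 − 1/W` is attained -/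

/-- **Every eigenvalue of the independence sampler with a real eigenfunction `⊥_p 1` is at most
`1 − 1/W`** (`p ≤ W·q`): it cannot be `1` (irreducibility: harmonic functions are constant, and a
constant orthogonal to `p` is `0`), so it is one of Liu's `λ_k`, all `≤ 1 − 1/W`.
[cite: Liu2001MonteCarlo, §13.4 Thm 13.4.1 (`1 > λ₁ ≥ ⋯ ≥ λ_{m−1}`, `λ₁ = 1 − 1/w₁`)];
[cite: LevinPeres2017, §12.1 Lemma 12.1 (ii)] -/
theorem imh_le_of_mem_orthEigenvalues (hp : ∀ x, 0 < p x) (hp1 : ∑ x, p x = 1)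
    (hq : ∀ x, 0 < q x) (hq1 : ∑ x, q x = 1) {W : ℝ} (hW : ∀ x, p x ≤ W * q x) {lam : ℝ}
    (hlam : lam ∈ orthEigenvalues p (mhKernel (fun _ z => q z) p : Matrix X X ℝ)) :
    lam ≤ 1 - W⁻¹ := by
  obtain ⟨f, hf0, hfp, hf⟩ := hlam
  have hfx : ∀ x, ∑ y, mhKernel (fun _ z => q z) p x y * f y = lam * f x := fun x => by
    have h := congrFun hf x
    simpa [Matrix.mulVec, dotProduct] using h
  by_cases h1 : lam = 1
  · -- a harmonic function of an irreducible chain is constant; a constant `⊥_p 1` is zero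
    exfalso
    subst h1
    rw [one_smul] at hf
    have hc := LevinPeres2017_lemma_12_1_ii (imh_isRowStochastic hp hq hq1)
      (imh_isIrreducible hp hq hq1) hf
    obtain ⟨x₀, hx₀⟩ : ∃ x, f x ≠ 0 := Function.ne_iff.mp hf0
    have hsum : ∑ x, p x * f x = f x₀ := by
      rw [sum_congr rfl fun x _ => by rw [hc x x₀], ← sum_mul, hp1, one_mul]
    exact hx₀ (hsum ▸ hfp)
  · -- otherwise `λ` is a genuine nontrivial (complex) eigenvalue, hence some `λ_k ≤ 1 − 1/W`
    have hfC : ∀ x, ∑ y, (mhKernel (fun _ z => q z) p x y : ℂ) * (f y : ℂ) =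
        (lam : ℂ) * (f x : ℂ) := fun x => by exact_mod_cast hfx x
    have hf0C : (fun x => (f x : ℂ)) ≠ 0 := by
      obtain ⟨x₀, hx₀⟩ : ∃ x, f x ≠ 0 := Function.ne_iff.mp hf0
      intro h
      have := congrFun h x₀
      simp only [Pi.zero_apply, Complex.ofReal_eq_zero] at this
      exact hx₀ this
    have hev : Module.End.HasEigenvector
        (Matrix.toLin' fun x y => (mhKernel (fun _ z => q z) p x y : ℂ)) (lam : ℂ)
        (fun x => (f x : ℂ)) :=
      (hasEigenvector_iff _ _ _).mpr ⟨hf0C, hfC⟩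
    have hmem : (lam : ℂ) ∈ nontrivialEigenvalues (mhKernel (fun _ z => q z) p) :=
      ⟨Module.End.hasEigenvalue_of_hasEigenvector hev, by exact_mod_cast h1⟩
    have hle := imh_norm_le_of_mem_nontrivialEigenvalues hp hp1 hq hq1 hW hmem
    rw [Complex.norm_real, Real.norm_eq_abs] at hle
    exact (le_abs_self lam).trans hle

/-- **`1 − 1/W` is an eigenvalue with a real eigenfunction `⊥_p 1`**: Liu's vector `v_{x⋆}` of the
mode `x⋆` (`p x⋆ = W q x⋆`, tail set = all other states) has `A v = (1 − 1/W) v`, `v ≢ 0`,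
`⟨v, 1⟩_p = S_p · p_{x⋆} − p_{x⋆} · S_p = 0`. [cite: Liu2001MonteCarlo, §13.4 Thm 13.4.1 (the
eigenpair `(λ₁, v₁)`)]; [cite: Liu1996IMH, Thm 2.1] -/
theorem imh_one_sub_inv_mem_orthEigenvalues (hp : ∀ x, 0 < p x) (hp1 : ∑ x, p x = 1)
    (hq : ∀ x, 0 < q x) (hq1 : ∑ x, q x = 1) {W : ℝ} (hW : ∀ x, p x ≤ W * q x) {xs : X}
    (hxs : p xs = W * q xs) (hX : ∃ y, y ≠ xs) :
    1 - W⁻¹ ∈ orthEigenvalues p (mhKernel (fun _ z => q z) p : Matrix X X ℝ) := by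
  obtain ⟨y, hy⟩ := hX
  set D : Finset X := univ.erase xs with hDdef
  have hk : xs ∉ D := by simp [hDdef]
  have hwxs : p xs / q xs = W := by rw [hxs, mul_div_assoc, div_self (hq xs).ne', mul_one]
  have hD : ∀ j ∈ D, p j / q j ≤ p xs / q xs := fun j _ => by
    rw [hwxs, div_le_iff₀ (hq j)]; exact hW j
  have hU : ∀ j ∉ D, p xs / q xs ≤ p j / q j := fun j hj => by
    have : j = xs := by simpa [hDdef] using hj
    rw [this]
  refine ⟨liuVector p xs D, ?_, ?_, ?_⟩
  · -- `v x⋆ = S_p(D) > 0`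
    intro h0
    have h1 := congrFun h0 xs
    rw [Pi.zero_apply, liuVector_apply_self hk] at h1
    have hyD : y ∈ D := by simp [hDdef, hy]
    have : 0 < ∑ j ∈ D, p j := sum_pos (fun j _ => hp j) ⟨y, hyD⟩
    linarith
  · -- `⟨v, 1⟩_p = 0`
    rw [sum_mul_liuVector p p xs D]
    ring
  · -- `A v = λ_{x⋆} v = (1 − 1/W) v`
    funext x
    rw [Pi.smul_apply, smul_eq_mul, ← imhEigenvalue_mode hp hp1 hq hq1 hW hxs]
    simpa [Matrix.mulVec, dotProduct] using imh_sum_kernel_mul_liuVector hp hq hq1 hk hD hU x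

/-! ## `λ₂ = 1 − 1/W`, `γ = Gap_R = 1/W` -/

/-- **The second eigenvalue of the independence sampler is `λ₂ = λ₁(Liu) = 1 − 1/w⋆`.**
[cite: Liu2001MonteCarlo, §13.4 Thm 13.4.1 and the paragraph before Lemma 13.4.1 ("the second
largest eigenvalue `λ₁` … equal to `1 − 1/w₁`")]; [cite: Liu1996IMH, Thm 2.1];
[cite: Wang2022IMHExact, §4 Thm 8]; `λ₂` of [cite: LevinPeres2017, §12.2 eq. (12.7)] -/
theorem imh_secondEigenvalue_eq (hp : ∀ x, 0 < p x) (hp1 : ∑ x, p x = 1) (hq : ∀ x, 0 < q x)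
    (hq1 : ∑ x, q x = 1) {W : ℝ} (hW : ∀ x, p x ≤ W * q x) {xs : X} (hxs : p xs = W * q xs)
    (hX : ∃ y, y ≠ xs) :
    secondEigenvalue p (mhKernel (fun _ z => q z) p : Matrix X X ℝ) = 1 - W⁻¹ := by
  have hgt : IsGreatest (orthEigenvalues p (mhKernel (fun _ z => q z) p : Matrix X X ℝ))
      (1 - W⁻¹) :=
    ⟨imh_one_sub_inv_mem_orthEigenvalues hp hp1 hq hq1 hW hxs hX,
      fun _ hlam => imh_le_of_mem_orthEigenvalues hp hp1 hq hq1 hW hlam⟩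
  exact hgt.csSup_eq

/-- **The spectral gap of the independence sampler is `γ = 1 − λ₂ = 1/w⋆`.**
[cite: Liu2001MonteCarlo, §13.4 Thm 13.4.1 (`λ₁ = 1 − 1/w₁`)]; [cite: Liu1996IMH, Thm 2.1];
[cite: Wang2022IMHExact, §4 Thm 8]; `γ := 1 − λ₂` of [cite: LevinPeres2017, §12.2] -/
theorem imh_spectralGap_eq (hp : ∀ x, 0 < p x) (hp1 : ∑ x, p x = 1) (hq : ∀ x, 0 < q x)
    (hq1 : ∑ x, q x = 1) {W : ℝ} (hW : ∀ x, p x ≤ W * q x) {xs : X} (hxs : p xs = W * q xs)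
    (hX : ∃ y, y ≠ xs) :
    spectralGap p (mhKernel (fun _ z => q z) p : Matrix X X ℝ) = W⁻¹ := by
  unfold spectralGap
  rw [imh_secondEigenvalue_eq hp hp1 hq hq1 hW hxs hX]
  ring

/-- **The right spectral gap of the independence sampler is `Gap_R = 1/w⋆`**:
`inf{𝓔(f) : f ⊥_p 1, ‖f‖_p = 1} = 1/W` (Lemma 13.7, `A` being reversible with respect to `p`).
[cite: Liu2001MonteCarlo, §13.4 Thm 13.4.1]; [cite: Liu1996IMH, Thm 2.1]; [cite: Wang2022IMHExact,
§4 Thm 8]; [cite: LevinPeres2017, §13.2.1 Lemma 13.7] -/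
theorem imh_spectralGapR_eq [Nontrivial X] (hp : ∀ x, 0 < p x) (hp1 : ∑ x, p x = 1)
    (hq : ∀ x, 0 < q x) (hq1 : ∑ x, q x = 1) {W : ℝ} (hW : ∀ x, p x ≤ W * q x) {xs : X}
    (hxs : p xs = W * q xs) :
    spectralGapR p (mhKernel (fun _ z => q z) p : Matrix X X ℝ) = W⁻¹ := by
  rw [← LevinPeres2017_lemma_13_7 hp hp1 (imh_isRowStochastic hp hq hq1)
    (mhKernel_detailedBalance hp _), imh_spectralGap_eq hp hp1 hq hq1 hW hxs (exists_ne xs)]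

/-- **`Gap_R = 1/w(x⋆) = (max_x p x / q x)⁻¹`** named by a heaviest state `x⋆` (at least two states).
[cite: Liu2001MonteCarlo, §13.4 Thm 13.4.1]; [cite: Liu1996IMH, Thm 2.1]; [cite: LevinPeres2017,
§13.2.1 Lemma 13.7] -/
theorem imh_spectralGapR_eq_maxWeight [Nontrivial X] (hp : ∀ x, 0 < p x) (hp1 : ∑ x, p x = 1)
    (hq : ∀ x, 0 < q x) (hq1 : ∑ x, q x = 1) {xs : X} (hmax : ∀ x, p x / q x ≤ p xs / q xs) :
    spectralGapR p (mhKernel (fun _ z => q z) p : Matrix X X ℝ) = (p xs / q xs)⁻¹ := by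
  have hW : ∀ x, p x ≤ p xs / q xs * q x := fun x => by
    have := hmax x
    rwa [div_le_iff₀ (hq x)] at this
  have hxs : p xs = p xs / q xs * q xs := by rw [div_mul_cancel₀ _ (hq xs).ne']
  exact imh_spectralGapR_eq hp hp1 hq hq1 hW hxs

/-- **For the independence sampler `γ = γ⋆ = 1/w⋆`**: the spectral gap and the absolute spectral gap
coincide (Liu: every eigenvalue is `≥ 0`), so `t_rel = 1/γ⋆ = 1/γ = 1/Gap_R = w⋆`
(`imh_relaxationTime_eq`). [cite: Liu2001MonteCarlo, §13.4 Thm 13.4.1 (`λ_{m−1} ≥ 0`)];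
`γ`, `γ⋆` of [cite: LevinPeres2017, §12.2] -/
theorem imh_spectralGap_eq_absSpectralGap (hp : ∀ x, 0 < p x) (hp1 : ∑ x, p x = 1)
    (hq : ∀ x, 0 < q x) (hq1 : ∑ x, q x = 1) {W : ℝ} (hW : ∀ x, p x ≤ W * q x) {xs : X}
    (hxs : p xs = W * q xs) (hX : ∃ y, y ≠ xs) :
    spectralGap p (mhKernel (fun _ z => q z) p : Matrix X X ℝ) =
      absSpectralGap (mhKernel (fun _ z => q z) p) := by
  rw [imh_spectralGap_eq hp hp1 hq hq1 hW hxs hX, imh_absSpectralGap_eq hp hp1 hq hq1 hW hxs hX]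

end Literature.Probability.MarkovChains
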